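import Summits.QuantumFields.BalabanUV.Beta.FP.KernelReflectionBounded
import Summits.QuantumFields.BalabanUV.Beta.FP.PerfectPolarizationWard
import Literature.MathematicalPhysics.QuantumFieldTheory.Balaban1983to89.Beta.OneStepKernelFamily

/-!
# `BalabanUV.Beta.FP.PerfectPolarizationReflection` — road «FP» for binder row D1, sub-row **H2-ASM-5a** (symmetry letters of `PiBF`), REFLECTION HALF (Kcov), module R2 (layer a):
# `AxisReflectionCovariant (flipK (PiBF wg wgh V W v w))` — THE PRINTED SINGLE-AXIS REFLECTION COVARIANCE (5.7)–(5.8) OF THE BF PERFECT POLARIZATION OVER ABSTRACT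
# ADMISSIBLE VERTEX DATA, from the bounded-leg covariance theorem (`KernelReflectionBounded`) at blocking `N = 1` in both sectors, under DISPLAYED leg ∕ vertex reflection letters

HONEST DEPENDENCY (page 1, mandatory): continuum YM on T⁴ ⇐ BetaPertH ∧ nine spine estimates (0/9 proved); BetaPertH ⇐ (D1) ∧ (D4) ∧ CAP+tail;
G-an2-4 gates asym, D1 and NE2/3/4.  HONEST FRAMING (cell contract, verbatim): «discharging `BetaPertH` makes Bałaban's UV stability UNCONDITIONAL —
a real constructive-QFT result; it is NOT the continuum limit and NOT the Clay problem.»  THIS MODULE DISCHARGES NOTHING of the wall: it instantiates R1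
(`KernelReflectionBounded.axisReflectionCovariant_flip_hessKer_bdd`) at the two legs of H2V-0's `PiBF` (`Pker`, `G0ker` — bounded and translation invariant, gan24-leaf-02's
`PerfectPolarizationWard.bdd_Pker`∕`bdd_G0ker`∕`blockCovariant_one` BY NAME) and combines the two sectors linearly; the inputs — localisation and translation covariance of the
vertex data, and for every axis `α` a leg relabelling leaving the leg invariant under which the vertex data obey the bond-reflection laws — are HYPOTHESES displayed in the
signature; 0 def, 0 `def … : Prop`, nothing cited (the two `[cite]` predicates `AxisReflectionCovariant`∕`reflSign` of `PolarizationSign` are the tree's typed reading of the printed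
law, used as the CONCLUSION's shape), 0 sorry; 0∕4 row-D1 binders; NOT the leg letters (L-REFL-P)∕(L-REFL-G) themselves (layer b `FP/PerfectPropagatorReflection`), NOT hgerm,
NOT D1, NOT BetaPertH, NOT continuum, NOT Clay.

ABSOLUTE RULE (cell charter, verbatim): «No internally-minted statement may enter as a cited fact. Every hypothesis is either kernel-proved in this package or a
verbatim quotation of a PUBLISHED theorem with page reference. The manuscript(s) under audit are NOT citable for their own disputed steps — they are the thing
under adjudication; programme-internal (2001/route/tribunal) claims are never citable.»

WHY (R-FP-32 l.26550, correcting R-FP-30: H2-ASM-5's letter list for `K := PiBF V3 W4` reads «(K6) + (Kcov) `AxisReflectionCovariant (flipK (PiBF …))` + (K0) + `hgerm`»; the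
(Kcov) letter feeds `TruncatedFirstMoment.abs_firstMoment_truncK_le_of_cov_flip` and the cov twins of the γ-END).  Every reflection producer for a `hessKer` in the tree took
`Decays A C δ` (located L-gan24leaf02-g39-2); R1 ported it to `Bdd`; this module is the `PiBF` instance at `N = 1`.
CONTENT ([folklore]∕[our object]):
* §1 `axisReflectionCovariant_lincomb` (the predicate is linear).
* §2 **`axisReflectionCovariant_flip_hessKer_one`**: ONE SECTOR at `N = 1` — bounded translation-invariant leg `A`, vertex data bi-localised at the unit-lattice bonds and
  translation covariant, and (R-letters) for every axis `α` a leg relabelling `Φα : KernelReflection.LegMap 4 Φ` with `refK Φα A = A` and an offset `c` such that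
  `V μ (bondRefl α c μ y) = reflSign α μ • refK Φα (V μ y)` and `W μ (bondRefl α c μ y) ν (bondRefl α c ν y′) = (reflSign α μ · reflSign α ν) • refK Φα (W μ y ν y′)`
  ⟹ `AxisReflectionCovariant (fun μ ν z => hessKer A V W μ ν (−z))`.
* §3 **`axisReflectionCovariant_flip_PiBF`** ∕ **`axisReflectionCovariant_flipK_PiBF`**: the same letters for `(Pker, V, W)` and `(G0ker, v, w)` ⟹
  `AxisReflectionCovariant (fun μ ν z => PiBF wg wgh V W v w μ ν (−z))` = `AxisReflectionCovariant (flipK (PiBF wg wgh V W v w))`, for EVERY pair of colour weights.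
For the road's data the letters are: (L-REFL-P) `refK Φα Pker = Pker` for the bond-reflection relabelling of the packed fibre (field legs `inl β`: site map `cflip α · − [β=α]e_α`,
sign `reflSign α β`) ⟸ `PerfectPropagatorSymbolPerm.PinfSym_phase` + `PerfectSymbolPerm.W166Inf_cflip` + a single-axis change of variables for `B4ContourShift.latticeKernel`
(layer b); (L-REFL-G) `refK Ψα G0ker = G0ker` ⟸ `latticeGreen ∘ cflip α = latticeGreen`; the vertex laws = H2V-DESIGN §2 (a7) for `V3 + sliceV3`, `W4 + sliceW4` and their ghost twins.
Provenance: D1 formalisation swarm seat b2b-balaban-beta-d1-formalise-leaf-02 gen 9 (road FP engine lineage; sub-row H2-ASM-5a (Kcov) REFLECTION HALF, «MINE (Kcov)» journal l.26728), 2026-08-21.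
-/

noncomputable section

namespace Summit.QuantumFields.BalabanUV.Beta.FP.PerfectPolarizationReflection

open Finset
open scoped BigOperators
open Literature.MathematicalPhysics.QuantumFieldTheory.Balaban1983to89
open Literature.MathematicalPhysics.QuantumFieldTheory.Balaban1983to89.Beta
open B12Sec2to5 (l1 l1_nonneg)
open B6BondElimination (unitVec)
open PolarizationSign (axisReflect reflSign AxisReflectionCovariant)
open ExpKernelCalculus (MKer Site BiLoc comp hessKer VertexFamily VertexFamily₂ BlockCovariant shiftK)
open OneStepResolventKernel (Fib)
open OneStepKernelFamily (flipK flipK_apply)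
open KernelWard (Bdd)
open KernelReflection (LegMap refK bondRefl)
open TwoPowerLegs (free)
open Summit.QuantumFields.BalabanUV.Beta.FP.PerfectPolarization (Pker G0ker PiBF PiBF_def Pker_translate G0ker_translate)
open Summit.QuantumFields.BalabanUV.Beta.FP.PerfectPropagatorLegData (A0P)
open Summit.QuantumFields.BalabanUV.Beta.FP.PerfectPolarizationWard (bdd_Pker bdd_G0ker blockCovariant_one)
open Summit.QuantumFields.BalabanUV.Beta.FP.KernelReflectionBounded (axisReflectionCovariant_flip_hessKer_bdd)

/-! ## §1 Linearity of the reflection predicate -/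

/-- [folklore] the reflection-covariance predicate is linear: a weighted difference of two covariant kernels is covariant. -/
theorem axisReflectionCovariant_lincomb {P Q : B12Beta.Kernel 4} (hP : AxisReflectionCovariant P) (hQ : AxisReflectionCovariant Q) (a b : ℝ) :
    AxisReflectionCovariant (fun μ ν z => a * P μ ν z - b * Q μ ν z) := by
  intro α μ ν z
  have h1 := hP α μ ν z
  have h2 := hQ α μ ν z
  show a * P μ ν _ - b * Q μ ν _ = reflSign α μ * reflSign α ν * (a * P μ ν z - b * Q μ ν z)
  rw [h1, h2]
  ring

/-! ## §2 Each sector: the flipped resolvent Hessian of a bounded leg over reflection-covariant localised vertex data is reflection covariant -/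

section Sectors

variable {Φ : Type*} [Fintype Φ] {A : MKer 4 Φ} {V : Fin 4 → Site 4 → MKer 4 Φ} {W : Fin 4 → Site 4 → Fin 4 → Site 4 → MKer 4 Φ}
  {C Cv Cw δ : ℝ}

/-- [folklore] **ONE SECTOR AT `N = 1`**: bounded translation-invariant leg, vertex data bi-localised at the unit-lattice bonds and translation covariant, and for every
axis `α` a leg relabelling `Φα` leaving the leg invariant under which the vertex data obey the bond-reflection laws with the bond map `bondRefl α c` and the signs `reflSign α`
⟹ `AxisReflectionCovariant (fun μ ν z => hessKer A V W μ ν (−z))` (`KernelReflectionBounded.axisReflectionCovariant_flip_hessKer_bdd` at `N = 1`). -/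
theorem axisReflectionCovariant_flip_hessKer_one (hAb : Bdd A C) (hA : ∀ t : Site 4, shiftK t A = A)
    (hV : ∀ (μ : Fin 4) (y : Site 4), BiLoc (V μ y) y y Cv δ) (hW : ∀ (μ : Fin 4) (y : Site 4) (ν : Fin 4) (y' : Site 4), BiLoc (W μ y ν y') y y' Cw δ)
    (hcovV : ∀ (μ : Fin 4) (y t : Site 4), V μ (y + t) = shiftK (-t) (V μ y))
    (hcovW : ∀ (μ : Fin 4) (y : Site 4) (ν : Fin 4) (y' t : Site 4), W μ (y + t) ν (y' + t) = shiftK (-t) (W μ y ν y'))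
    (hδ : 0 < δ)
    (hrefl : ∀ α : Fin 4, ∃ Φα : LegMap 4 Φ, refK Φα A = A ∧ ∃ c : ℤ,
      (∀ μ y, V μ (bondRefl α c μ y) = reflSign α μ • refK Φα (V μ y)) ∧
      (∀ μ y ν y', W μ (bondRefl α c μ y) ν (bondRefl α c ν y') = (reflSign α μ * reflSign α ν) • refK Φα (W μ y ν y'))) :
    AxisReflectionCovariant (fun μ ν z => hessKer A V W μ ν (-z)) := by
  have hV' : VertexFamily V 1 Cv δ := fun μ y => by simpa using hV μ y
  have hW' : VertexFamily₂ W 1 Cw δ := fun μ y ν y' => by simpa using hW μ y ν y'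
  exact axisReflectionCovariant_flip_hessKer_bdd hAb hV' hW' hδ (blockCovariant_one hA hcovV hcovW) hrefl

end Sectors

/-! ## §3 The BF perfect polarization over admissible data is reflection covariant -/

/-- [our object] **`AxisReflectionCovariant (fun μ ν z => PiBF wg wgh V W v w μ ν (−z))`** — THE REFLECTION LETTER (Kcov) OF H2-ASM-5a: for gluon-sector data `(V, W)` on the
packed fibre and ghost-sector data `(v, w)` on the scalar fibre, each bi-localised at the unit-lattice bonds and translation covariant, and for every axis `α` leg relabellings
`Φα` ∕ `Ψα` leaving `Pker` ∕ `G0ker` invariant ((L-REFL-P) ∕ (L-REFL-G)) under which the vertex data obey the bond-reflection laws, the flipped BF perfect polarization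
`z ↦ PiBF wg wgh V W v w μ ν (−z)` satisfies the printed single-axis reflection covariance `PolarizationSign.AxisReflectionCovariant`, for EVERY pair of colour weights. -/
theorem axisReflectionCovariant_flip_PiBF (wg wgh : ℝ)
    {V : Fin 4 → Site 4 → MKer 4 (Fib 3)} {W : Fin 4 → Site 4 → Fin 4 → Site 4 → MKer 4 (Fib 3)}
    {v : Fin 4 → Site 4 → MKer 4 Unit} {w : Fin 4 → Site 4 → Fin 4 → Site 4 → MKer 4 Unit} {Cv Cw Cv' Cw' δ : ℝ} (hδ : 0 < δ)
    (hV : ∀ (μ : Fin 4) (y : Site 4), BiLoc (V μ y) y y Cv δ) (hW : ∀ (μ : Fin 4) (y : Site 4) (ν : Fin 4) (y' : Site 4), BiLoc (W μ y ν y') y y' Cw δ)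
    (hcovV : ∀ (μ : Fin 4) (y t : Site 4), V μ (y + t) = shiftK (-t) (V μ y))
    (hcovW : ∀ (μ : Fin 4) (y : Site 4) (ν : Fin 4) (y' t : Site 4), W μ (y + t) ν (y' + t) = shiftK (-t) (W μ y ν y'))
    (hreflP : ∀ α : Fin 4, ∃ Φα : LegMap 4 (Fib 3), refK Φα Pker = Pker ∧ ∃ c : ℤ,
      (∀ μ y, V μ (bondRefl α c μ y) = reflSign α μ • refK Φα (V μ y)) ∧
      (∀ μ y ν y', W μ (bondRefl α c μ y) ν (bondRefl α c ν y') = (reflSign α μ * reflSign α ν) • refK Φα (W μ y ν y')))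
    (hv : ∀ (μ : Fin 4) (y : Site 4), BiLoc (v μ y) y y Cv' δ) (hw : ∀ (μ : Fin 4) (y : Site 4) (ν : Fin 4) (y' : Site 4), BiLoc (w μ y ν y') y y' Cw' δ)
    (hcovv : ∀ (μ : Fin 4) (y t : Site 4), v μ (y + t) = shiftK (-t) (v μ y))
    (hcovw : ∀ (μ : Fin 4) (y : Site 4) (ν : Fin 4) (y' t : Site 4), w μ (y + t) ν (y' + t) = shiftK (-t) (w μ y ν y'))
    (hreflG : ∀ α : Fin 4, ∃ Ψα : LegMap 4 Unit, refK Ψα G0ker = G0ker ∧ ∃ c : ℤ,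
      (∀ μ y, v μ (bondRefl α c μ y) = reflSign α μ • refK Ψα (v μ y)) ∧
      (∀ μ y ν y', w μ (bondRefl α c μ y) ν (bondRefl α c ν y') = (reflSign α μ * reflSign α ν) • refK Ψα (w μ y ν y'))) :
    AxisReflectionCovariant (fun μ ν z => PiBF wg wgh V W v w μ ν (-z)) := by
  have h1 := axisReflectionCovariant_flip_hessKer_one bdd_Pker Pker_translate hV hW hcovV hcovW hδ hreflP
  have h2 := axisReflectionCovariant_flip_hessKer_one bdd_G0ker G0ker_translate hv hw hcovv hcovw hδ hreflG
  have h := axisReflectionCovariant_lincomb h1 h2 wg wgh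
  simpa only [PiBF_def] using h

/-- [our object] **`AxisReflectionCovariant (flipK (PiBF wg wgh V W v w))`** — the same letter in the `flipK` spelling consumed by the road (R-FP-32's `hcov` socket of
`TruncatedFirstMoment.abs_firstMoment_truncK_le_of_cov_flip` and of the γ-END cov twins). -/
theorem axisReflectionCovariant_flipK_PiBF (wg wgh : ℝ)
    {V : Fin 4 → Site 4 → MKer 4 (Fib 3)} {W : Fin 4 → Site 4 → Fin 4 → Site 4 → MKer 4 (Fib 3)}
    {v : Fin 4 → Site 4 → MKer 4 Unit} {w : Fin 4 → Site 4 → Fin 4 → Site 4 → MKer 4 Unit} {Cv Cw Cv' Cw' δ : ℝ} (hδ : 0 < δ)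
    (hV : ∀ (μ : Fin 4) (y : Site 4), BiLoc (V μ y) y y Cv δ) (hW : ∀ (μ : Fin 4) (y : Site 4) (ν : Fin 4) (y' : Site 4), BiLoc (W μ y ν y') y y' Cw δ)
    (hcovV : ∀ (μ : Fin 4) (y t : Site 4), V μ (y + t) = shiftK (-t) (V μ y))
    (hcovW : ∀ (μ : Fin 4) (y : Site 4) (ν : Fin 4) (y' t : Site 4), W μ (y + t) ν (y' + t) = shiftK (-t) (W μ y ν y'))
    (hreflP : ∀ α : Fin 4, ∃ Φα : LegMap 4 (Fib 3), refK Φα Pker = Pker ∧ ∃ c : ℤ,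
      (∀ μ y, V μ (bondRefl α c μ y) = reflSign α μ • refK Φα (V μ y)) ∧
      (∀ μ y ν y', W μ (bondRefl α c μ y) ν (bondRefl α c ν y') = (reflSign α μ * reflSign α ν) • refK Φα (W μ y ν y')))
    (hv : ∀ (μ : Fin 4) (y : Site 4), BiLoc (v μ y) y y Cv' δ) (hw : ∀ (μ : Fin 4) (y : Site 4) (ν : Fin 4) (y' : Site 4), BiLoc (w μ y ν y') y y' Cw' δ)
    (hcovv : ∀ (μ : Fin 4) (y t : Site 4), v μ (y + t) = shiftK (-t) (v μ y))
    (hcovw : ∀ (μ : Fin 4) (y : Site 4) (ν : Fin 4) (y' t : Site 4), w μ (y + t) ν (y' + t) = shiftK (-t) (w μ y ν y'))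
    (hreflG : ∀ α : Fin 4, ∃ Ψα : LegMap 4 Unit, refK Ψα G0ker = G0ker ∧ ∃ c : ℤ,
      (∀ μ y, v μ (bondRefl α c μ y) = reflSign α μ • refK Ψα (v μ y)) ∧
      (∀ μ y ν y', w μ (bondRefl α c μ y) ν (bondRefl α c ν y') = (reflSign α μ * reflSign α ν) • refK Ψα (w μ y ν y'))) :
    AxisReflectionCovariant (flipK (PiBF wg wgh V W v w)) :=
  axisReflectionCovariant_flip_PiBF wg wgh hδ hV hW hcovV hcovW hreflP hv hw hcovv hcovw hreflG

end Summit.QuantumFields.BalabanUV.Beta.FP.PerfectPolarizationReflection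

end
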